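import Summits.ResolutionOfSingularities.ResolutionOfSingularities.Theorems.FloorCutClasses
import Summits.ResolutionOfSingularities.ResolutionOfSingularities.Theorems.FloorCutFloor
import Summits.ResolutionOfSingularities.ResolutionOfSingularities.Theorems.ConeCutAxisLaw
import Summits.ResolutionOfSingularities.ResolutionOfSingularities.Theorems.BoundaryLedgerClasses
import Summits.ResolutionOfSingularities.ResolutionOfSingularities.Theorems.ItineraryCutClasses
import Summits.ResolutionOfSingularities.ResolutionOfSingularities.Theorems.ProximityCutClasses
import Summits.ResolutionOfSingularities.ResolutionOfSingularities.Theorems.ProximityCutOrigin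
import Literature.AlgebraicGeometry.Resolution.HasseSchmidtDiffEqDiffOp
import Literature.AlgebraicGeometry.Resolution.PointBlowupKangaroo
import HarnessLib

/-!
# ConeCutClasses — decomp-res node «ConeCut» (lens-3 g15 rev 5), tree file 1/11 (cone-free): the class
definitions the route must
import — `IsTameFrom` (tame high-plateau tails, LAW E shape), the located MIXED residual `NoMixedTailsDeep` and
its LAW-E re-typing
`NoTameMixedTailsDeep` (the ONE co-owned mixed aside under 31770, ≙ lens-5 `NoMixedExcessTailsDeep`; EXACT `mixed_iff_tame` in
`MaxContactCutConeCutCells`).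

Content VERBATIM from the decomp-res lens-3 g15 file `HOME/decomp-res-lens-3/g15/parts/ConeCut-rev5-f76e5309.lean`
(sha256 f76e53096babc227…; CRITIC-LEDGER
rows 102/105/110/123 CLEARED, landing orders 15:53:15Z / 17:40:15Z).  HOME = run/shared/lean/pub/decomp-res.  Host:
route `MaxContactCut`, aside
31770 `DefectWalksDeep` (and 31870) through the tree's lens-3 g14 `Theorems/FloorCut{Classes,Floor}` + `MaxContactCutFloorCut`.

[WRITER NOTE (decomp-res writer g6): per the lens's own landing instruction its §0 (l.130–876 = g14 `FloorCut`
VERBATIM) is DELETED and the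
tree's `…Theorems.FloorCut` opened instead; §C⁵ `section AxisLaw` (l.2949–3086) is the tree's
`Theorems/ConeCutAxisLaw` (landed earlier,
opened here); the restated ProximityCut letters `LeavesNewest` / `StaysOnNewest` / `leavesNewest_iff_not_stays` /
`NoFreePointTailsDeep`
(byte-identical to `Theorems/ProximityCutClasses`) are deleted and opened from the tree; the three class definitions
`IsTameFrom`,
`NoMixedTailsDeep`, `NoTameMixedTailsDeep` live in the cone-free `Theorems/ConeCutClasses` (so the route can import
the co-owned MIXED
aside).  Split: ConeCutClasses · ConeCutLayers / ConeCutLayersPoint (§A state level) · ConeCutWalks (§B) ·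
ConeCutLawB (§C) · ConeCutRepeats
(§B⁺, §B⁺⁺⁺ part 1) · ConeCutLawE (§B⁺⁺⁺ part 2, LAW E) · ConeCutZigzag (§B⁺⁺
Fibonacci/zigzag, LAW C) · ConeCutLaws (all-repeat rigidity,
LAW I, §D booking) · MaxContactCutConeCut / MaxContactCutConeCutCells (§D wiring to 31770/31870 BY NAME, Theses
cone).  ONE namespace
`…Theorems.ConeCut` as in the lens; global `set_option` lines dropped; nothing else changed.]
(Sources: Hauser2010 §§D,F,G; HauserPerlega2019; Moh1987; CossartPiltant2019; CossartJannsenSaito2020 Thm. 2.14,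
§§5,9; BenitoVillamayor2013 §7; CasasAlvero2000 Ch. 3; BierstoneGrigorievMilmanWlodarczyk2011 Def. 3.1.3.)
-/

noncomputable section

open MvPolynomial Finset
open Literature.AlgebraicGeometry.Resolution
open Literature.AlgebraicGeometry.Resolution.Hauser2010
open Literature.AlgebraicGeometry.Resolution.PointBlowup
open Summit.ResolutionOfSingularities.ResolutionOfSingularities.Theorems.TightDefectClasses
open Summit.ResolutionOfSingularities.ResolutionOfSingularities.Theorems.TightDefectStrongWalks
open Summit.ResolutionOfSingularities.ResolutionOfSingularities.Theorems.ItineraryCutClasses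
open Summit.ResolutionOfSingularities.ResolutionOfSingularities.Theorems.BoundaryLedger
open Literature.AlgebraicGeometry.Resolution.WeightedBlowup
open Literature.Barriers.ResolutionOfSingularities
open Summit.ResolutionOfSingularities.ResolutionOfSingularities.Theorems.FloorCut
open Summit.ResolutionOfSingularities.ResolutionOfSingularities.Theorems.ConeCutAxisLaw
open Summit.ResolutionOfSingularities.ResolutionOfSingularities.Theorems.ProximityCut (NoOriginTails LeavesNewest StaysOnNewest)
open Summit.ResolutionOfSingularities.ResolutionOfSingularities.Theorems.ProximityCut (leavesNewest_iff_not_stays NoFreePointTailsDeep)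

namespace Summit.ResolutionOfSingularities.ResolutionOfSingularities.Theorems.ConeCut

section Classes

variable {K : Type} [Field K] [DecidableEq K] {q : ℕ} {s₀ : State (Fin 3) K}

/-- A high-plateau tail is **TAME from `N` on**: every proximity repeat preceded by two proximity repeats is an
UNTRANSLATED ZIGZAG step (`b_{t+3} = 0`, `j_{t+3} = j_{t+1}`) — translations sit only at newest-free moves and at the
first two repeats of each repeat run.  DEFINITION (support); holds on every high plateau by LAW E. -/
def IsTameFrom (W : ForcedWalk q s₀) (N : ℕ) : Prop :=
  ∀ t, N ≤ t → StaysOnNewest W t → StaysOnNewest W (t + 1) → StaysOnNewest W (t + 2) →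
    W.b (t + 3) = 0 ∧ W.j (t + 3) = W.j (t + 1)

end Classes

/-- PIECE · MIXED TAILS (the other LOCATED residual) — high plateaux, translations i.o., with proximity repeats AND
newest-free moves BOTH infinitely often (every late repeat a cone-line repeat by the POWER LAW, every chart-switching
double repeat translated by the DOUBLE-REPEAT LAW).  UNDECIDED · IDEA-NEEDED (SEED §1⁺⁺ (M2)). -/
def NoMixedTailsDeep : Prop :=
  ∀ p : ℕ, p.Prime → ∀ e : ℕ, 2 ≤ e → ∀ (K : Type) [Field K] [CharP K p] [PerfectField K] [DecidableEq K]
    (s₀ : State (Fin 3) K), IsRoot (p ^ e) s₀ → ∀ W : ForcedWalk (p ^ e) s₀,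
    ∀ N s : ℕ, 2 ≤ s → s < p ^ e →
    (∀ t, N ≤ t → (W.st t).shade = (s : ℕ∞) ∧ ((p ^ e : ℕ) : ℕ∞) < ordZero (W.st t).F) →
    (∀ M : ℕ, ∃ i, M ≤ i ∧ W.b i ≠ 0) →
    (∀ M : ℕ, ∃ t, M ≤ t ∧ StaysOnNewest W t) → (∀ M : ℕ, ∃ t, M ≤ t ∧ LeavesNewest W t) → False

/-! ### §D.4e LAW E re-types the MIXED residual as TAME mixed words (g15 rev 4) -/

/-- PIECE · TAME MIXED TAILS (the mixed residual RE-TYPED by LAW E) — high plateaux, translations i.o., both letters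
i.o., AND tame from `N` on: every repeat preceded by two repeats is an untranslated zigzag step (translations only at
F-moves and at the first two repeats of each repeat run).  ≡ `NoMixedTailsDeep` (`mixed_iff_tame`, EXACT, PROVED) —
the sharper TYPED class of the mixed residual; UNDECIDED. -/
def NoTameMixedTailsDeep : Prop :=
  ∀ p : ℕ, p.Prime → ∀ e : ℕ, 2 ≤ e → ∀ (K : Type) [Field K] [CharP K p] [PerfectField K] [DecidableEq K]
    (s₀ : State (Fin 3) K), IsRoot (p ^ e) s₀ → ∀ W : ForcedWalk (p ^ e) s₀,
    ∀ N s : ℕ, 2 ≤ s → s < p ^ e →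
    (∀ t, N ≤ t → (W.st t).shade = (s : ℕ∞) ∧ ((p ^ e : ℕ) : ℕ∞) < ordZero (W.st t).F) →
    (∀ M : ℕ, ∃ i, M ≤ i ∧ W.b i ≠ 0) →
    (∀ M : ℕ, ∃ t, M ≤ t ∧ StaysOnNewest W t) → (∀ M : ℕ, ∃ t, M ≤ t ∧ LeavesNewest W t) →
    IsTameFrom W N → False

end Summit.ResolutionOfSingularities.ResolutionOfSingularities.Theorems.ConeCut
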